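import Summits.AtomisticToContinuum.FouriersLaw.Theorems.ConductanceLowerBound.Negative.AbelInsulatorOfCurrentCoboundary

/-!
# Approximate coboundaries are approximate Abel insulators — the quantitative kill criterion of W⁻
(strategist s3 on crux `ConductanceLowerBound` = stmt-AtomisticToContinuum-11749, Negation / Strengthen headings of
`Cruxes/ConductanceLowerBound/STRATEGY-CENSUS-s3-CP.md`; abstract Hilbert-space lemma over the tree's unitary-group calculus;
no sorry, no new definitions; candidate for `Theorems/ConductanceLowerBound/Negative/` by a prover — this seat cannot write Theorems.)

p162590 (`Negative/AbelInsulatorOfCurrentCoboundary`) typed the EXACT kill: `[J] = Lφ` in `ℋ₀` ⟹ Abel functional `≤ ν‖φ‖² → 0`.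
De Roeck–Huveneers' asymptotic localisation never produces an exact primitive, only `[J] = Lφ_n + r_n` with `‖r_n‖ = O(g^{n+1})`
order by order.  The lemma below is the form such a refutation would actually need, and it shows exactly how far it reaches:

* `abel_le_of_approxCoboundary` (any strongly continuous unitary group `U(t) = e^{tA}` on a complex Hilbert space, `φ ∈ D(A)`,
  any `r`, `ν > 0`):  `∫₀^∞ e^{−νt} Re⟪Aφ + r, U(t)(Aφ + r)⟫ dt ≤ 2ν‖φ‖² + 2‖r‖²/ν`.
  Proof: the Abel functional is `ν‖R(ν)ψ‖²` (landed `UnitaryRep.integral_exp_neg_mul_re_inner_appReal`), `R(ν)` is linear with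
  `‖R(ν)‖ ≤ 1/ν` (Engel–Nagel (1.14)), and `ν‖R(ν)Aφ‖² ≤ ν‖φ‖²` is p162590's `integral_exp_neg_mul_re_inner_appReal_generator_le`.
* This is the `b = φ` instance of the classical INF variational formula `⟪g,(ν−A)⁻¹g⟫ = inf_f {ν‖f‖² + ν⁻¹‖g + Af‖²}` for a
  skew generator (Sethuraman 2000; Bernardin–Olla 2011 eq. (var) with the noise switched off) — up to the factor 2 it is sharp.
  CONSEQUENCES recorded in the census: (i) "heat-odometer" reformulation of the bulk Abel floor W (liminf form):
  W fails iff there are `φ_k ∈ D(L) ⊂ ℋ₀` with `‖[J] − Lφ_k‖·‖φ_k‖ → 0` and `‖[J] − Lφ_k‖/‖φ_k‖ → 0`; (ii) an order-`n` De Roeck–Huveneers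
  primitive (`‖r_n‖ ≤ C_n g^{n+1}`, `‖φ_n‖ = O(1)`) bounds `Â(ν)` only down to frequencies `ν ≍ C_n g^{n}` (value `O(C_n g^{n+1})`);
  reaching `ν → 0` at fixed coupling `g` needs `n → ∞`, i.e. a CONVERGENT (KAM-type) primitive, which is exactly what asymptotic
  localisation does not give (Gevrey growth of `C_n`).  So the all-orders insulator refutes no `limsup_{ν↓0}` statement: W⁻ survives it.
References: Engel–Nagel 2000 Ch. II Thm 1.10 and (1.14); Sethuraman 2000; Bernardin–Olla, J. Stat. Phys. 145 (2011) §6 eq. (var);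
De Roeck–Huveneers 2015.
-/

noncomputable section

open MeasureTheory Filter Set Topology
open scoped InnerProductSpace NNReal
open Literature.Analysis.UnboundedOperators

namespace Summit.AtomisticToContinuum.FouriersLaw.Cruxes.ConductanceLowerBound.StrategistS3

variable {H : Type*} [NormedAddCommGroup H] [InnerProductSpace ℂ H] [CompleteSpace H]

/-- `‖R(ν) r‖ ≤ ‖r‖ / ν` for the Laplace transform `R(ν) = ∫₀^∞ e^{−νt} U(t) dt` of the orbit of a unitary group, `ν > 0`
(Engel–Nagel (1.14) with `M = 1`, `ω = 0`). [cite: EngelNagel2000, Ch. II Thm. 1.10 (1.14)] -/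
theorem norm_laplaceResolventFun_unitary_le (U : OneParameterUnitaryGroup H) {ν : ℝ} (hν : 0 < ν) (r : H) :
    ‖(OneParameterGroup.toC0Semigroup U.toStrongContRepresentation).laplaceResolventFun (ν : ℂ) r‖ ≤ ‖r‖ / ν := by
  have hM := U.norm_toC0Semigroup_app_le
  have hl : (0 : ℝ) < ((ν : ℂ)).re := by simpa using hν
  have h := C0Semigroup.norm_laplaceResolventFun_le _ hM hl r
  have hre : ((ν : ℂ)).re = ν := Complex.ofReal_re ν
  have hint : ∫ t in Ioi (0 : ℝ), Real.exp ((0 - ((ν : ℂ)).re) * t) = ν⁻¹ := by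
    rw [hre, zero_sub, integral_exp_mul_Ioi (neg_lt_zero.mpr hν) 0, mul_zero, Real.exp_zero, neg_div, one_div,
      inv_neg, neg_neg]
  rw [hint, one_mul] at h
  calc ‖(OneParameterGroup.toC0Semigroup U.toStrongContRepresentation).laplaceResolventFun (ν : ℂ) r‖
      ≤ ν⁻¹ * ‖r‖ := h
    _ = ‖r‖ / ν := by rw [div_eq_inv_mul]

/-- **Approximate coboundaries are approximate Abel insulators.**  For a strongly continuous one-parameter unitary group `U`
with generator `A`, `φ ∈ D(A)`, any `r : H` and `ν > 0`:
`∫₀^∞ e^{−νt} Re⟪Aφ + r, U(t)(Aφ + r)⟫ dt ≤ 2ν‖φ‖² + 2‖r‖²/ν`.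
With `r = 0` this is p162590's exact-coboundary bound (up to the factor 2); it is the `f = φ` instance of the inf variational
formula for `⟪ψ,(ν − A)⁻¹ψ⟫` (Sethuraman; Bernardin–Olla 2011 eq. (var)). [cite: EngelNagel2000, Ch. II Thm. 1.10] -/
theorem abel_le_of_approxCoboundary (U : OneParameterUnitaryGroup H) {ν : ℝ} (hν : 0 < ν)
    (φ : (OneParameterGroup.generator U.toStrongContRepresentation).domain) (r : H) :
    ∫ t in Ioi (0 : ℝ), Real.exp (-(ν * t)) *
        (⟪(OneParameterGroup.generator U.toStrongContRepresentation φ : H) + r,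
          U.appReal t ((OneParameterGroup.generator U.toStrongContRepresentation φ : H) + r)⟫_ℂ).re ≤
      2 * (ν * ‖(φ : H)‖ ^ 2) + 2 * (‖r‖ ^ 2 / ν) := by
  set T := OneParameterGroup.toC0Semigroup U.toStrongContRepresentation with hT
  have hM := U.norm_toC0Semigroup_app_le
  have hl : (0 : ℝ) < ((ν : ℂ)).re := by simpa using hν
  have hν0 : ν ≠ 0 := hν.ne'
  set ψ : H := (OneParameterGroup.generator U.toStrongContRepresentation φ : H) with hψ
  -- the Abel functional of `ψ + r` is `ν ‖R(ν)(ψ + r)‖² = ν ‖R(ν)ψ + R(ν)r‖²`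
  rw [U.integral_exp_neg_mul_re_inner_appReal hν (ψ + r), ← U.laplaceResolventFun_toC0Semigroup_eq,
    C0Semigroup.laplaceResolventFun_add T hM hl ψ r]
  -- `ν ‖R(ν)ψ‖² = Abel(Aφ) ≤ ν ‖φ‖²` (p162590)
  have hA : ν * ‖T.laplaceResolventFun (ν : ℂ) ψ‖ ^ 2 ≤ ν * ‖(φ : H)‖ ^ 2 := by
    have h1 := AbelFloorExchange.UnitaryAbel.integral_exp_neg_mul_re_inner_appReal_generator_le U hν φ
    rw [U.integral_exp_neg_mul_re_inner_appReal hν ψ, ← U.laplaceResolventFun_toC0Semigroup_eq] at h1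
    exact h1
  -- `‖R(ν) r‖ ≤ ‖r‖ / ν`
  have hB : ‖T.laplaceResolventFun (ν : ℂ) r‖ ≤ ‖r‖ / ν := norm_laplaceResolventFun_unitary_le U hν r
  have hB2 : ν * ‖T.laplaceResolventFun (ν : ℂ) r‖ ^ 2 ≤ ‖r‖ ^ 2 / ν := by
    have h0 : 0 ≤ ‖T.laplaceResolventFun (ν : ℂ) r‖ := norm_nonneg _
    have h2 : ‖T.laplaceResolventFun (ν : ℂ) r‖ ^ 2 ≤ (‖r‖ / ν) ^ 2 := by gcongr
    calc ν * ‖T.laplaceResolventFun (ν : ℂ) r‖ ^ 2 ≤ ν * (‖r‖ / ν) ^ 2 := mul_le_mul_of_nonneg_left h2 hν.le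
      _ = ‖r‖ ^ 2 / ν := by field_simp
  -- `‖a + b‖² ≤ 2‖a‖² + 2‖b‖²`
  have hab : ‖T.laplaceResolventFun (ν : ℂ) ψ + T.laplaceResolventFun (ν : ℂ) r‖ ^ 2 ≤
      2 * ‖T.laplaceResolventFun (ν : ℂ) ψ‖ ^ 2 + 2 * ‖T.laplaceResolventFun (ν : ℂ) r‖ ^ 2 := by
    have h3 := norm_add_le (T.laplaceResolventFun (ν : ℂ) ψ) (T.laplaceResolventFun (ν : ℂ) r)
    have h4 : 0 ≤ ‖T.laplaceResolventFun (ν : ℂ) ψ + T.laplaceResolventFun (ν : ℂ) r‖ := norm_nonneg _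
    nlinarith [h3, h4, norm_nonneg (T.laplaceResolventFun (ν : ℂ) ψ), norm_nonneg (T.laplaceResolventFun (ν : ℂ) r),
      sq_nonneg (‖T.laplaceResolventFun (ν : ℂ) ψ‖ - ‖T.laplaceResolventFun (ν : ℂ) r‖)]
  calc ν * ‖T.laplaceResolventFun (ν : ℂ) ψ + T.laplaceResolventFun (ν : ℂ) r‖ ^ 2
      ≤ ν * (2 * ‖T.laplaceResolventFun (ν : ℂ) ψ‖ ^ 2 + 2 * ‖T.laplaceResolventFun (ν : ℂ) r‖ ^ 2) :=
        mul_le_mul_of_nonneg_left hab hν.le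
    _ = 2 * (ν * ‖T.laplaceResolventFun (ν : ℂ) ψ‖ ^ 2) + 2 * (ν * ‖T.laplaceResolventFun (ν : ℂ) r‖ ^ 2) := by ring
    _ ≤ 2 * (ν * ‖(φ : H)‖ ^ 2) + 2 * (‖r‖ ^ 2 / ν) := by linarith

/-- **The odometer form.**  Same bound stated for an arbitrary vector `ψ` and an arbitrary candidate primitive `φ ∈ D(A)`:
`Abel_ν(ψ) ≤ 2ν‖φ‖² + 2‖ψ − Aφ‖²/ν`.  Minimising over `ν` at fixed `φ` gives `≤ 4‖φ‖·‖ψ − Aφ‖` at `ν = ‖ψ − Aφ‖/‖φ‖`: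
a floor `Abel_ν(ψ) ≥ a` on `(0, ν₀)` forces every candidate primitive with relative defect `‖ψ − Aφ‖ ≤ ν₀‖φ‖` to have
COST `‖ψ − Aφ‖·‖φ‖ ≥ a/4` (an uncertainty inequality for approximate primitives of the current). [cite: EngelNagel2000, Ch. II Thm. 1.10] -/
theorem abel_le_of_candidatePrimitive (U : OneParameterUnitaryGroup H) {ν : ℝ} (hν : 0 < ν) (ψ : H)
    (φ : (OneParameterGroup.generator U.toStrongContRepresentation).domain) :
    ∫ t in Ioi (0 : ℝ), Real.exp (-(ν * t)) * (⟪ψ, U.appReal t ψ⟫_ℂ).re ≤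
      2 * (ν * ‖(φ : H)‖ ^ 2) +
        2 * (‖ψ - (OneParameterGroup.generator U.toStrongContRepresentation φ : H)‖ ^ 2 / ν) := by
  have h := abel_le_of_approxCoboundary U hν φ (ψ - (OneParameterGroup.generator U.toStrongContRepresentation φ : H))
  rwa [add_sub_cancel] at h

/-- **Uncertainty inequality for approximate primitives** (the contrapositive reading used in the census): if the Abel functional
of `ψ` is at least `a` at some frequency `ν > 0`, then every `φ ∈ D(A)` satisfies `a ≤ 2ν‖φ‖² + 2‖ψ − Aφ‖²/ν`; in particular no
`φ` has both `ν‖φ‖² < a/4` and `‖ψ − Aφ‖² < aν/4`. [cite: EngelNagel2000, Ch. II Thm. 1.10] -/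
theorem primitive_cost_of_abelFloor (U : OneParameterUnitaryGroup H) {ν a : ℝ} (hν : 0 < ν) (ψ : H)
    (hfloor : a ≤ ∫ t in Ioi (0 : ℝ), Real.exp (-(ν * t)) * (⟪ψ, U.appReal t ψ⟫_ℂ).re)
    (φ : (OneParameterGroup.generator U.toStrongContRepresentation).domain) :
    a ≤ 2 * (ν * ‖(φ : H)‖ ^ 2) +
      2 * (‖ψ - (OneParameterGroup.generator U.toStrongContRepresentation φ : H)‖ ^ 2 / ν) :=
  hfloor.trans (abel_le_of_candidatePrimitive U hν ψ φ)

end Summit.AtomisticToContinuum.FouriersLaw.Cruxes.ConductanceLowerBound.StrategistS3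

end
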